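import Literature.Analysis.DeBrangesSpaces.BurnolCosineKernelAnalyticContinuation
import Literature.Analysis.DeBrangesSpaces.BurnolSonineCommonZerosProofs
import Literature.Analysis.DeBrangesSpaces.BurnolXPairingRepresenters
import Literature.Analysis.DeBrangesSpaces.BurnolXPairingKernelIdentity
import HarnessLib

/-!
# Burnol 2001 (CRAS 333), §1, proof of Thm. 1.5: a combination of the vectors `X^λ_{w,k}`
# orthogonal to `K_{λ,λ}` is an entire function on `(0, ∞)`

First half of Burnol's proof of Théorème 1.5 (TeX l.409–412): "Supposons qu'une combinaison
linéaire finie des `X^λ_{w,k}` soit dans `K_{λ,λ}^⊥ = L²(]0,λ]) + 𝓕₊(L²(]0,λ]))`.  Comme dans la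
démonstration précédente, la combinaison linéaire correspondante des `D_{w,k}(t)` (qui est analytique
en `t` sur `]0,∞[`) doit être dans `𝓕₊(L²(]0,λ]))`" — so it is (the restriction of) an ENTIRE
function.  In the tree's rendering of the theorem (`Burnol2001CRAS_thm1_5C`: the functionals
`f ↦ (f, X^λ_{w,k}]` on `K_{λ,λ}`), the hypothesis "`Σ c_{w,k} (f, X^λ_{w,k}] = 0` for all `f ∈ K_{λ,λ}`"
gives (`exists_entire_eq_sum_of_pairings_eq_zero`): there is an entire `E` with

  `Σ_{(w,k)} c_{w,k} D_{w,k}(t) = E(t)` for ALL `t > 0`,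

where `D_{w,k}(t) = (log 1/t)^k t^{−w}` (`Re w > 1/2`) and `= ∂_w^k C_λ(t,w)` (`Re w ≤ 1/2`).  Inputs,
all tree theorems: the printed pairing identities (`xPairingR_eq_setIntegral_of_re_gt/le`), the
vectors as `L²(ℝ)` classes (`BurnolXPairingRepresenters`), "an even vector orthogonal to `K_{λ,λ}` lies
in `ran P_λ ⊔ ran P̂_λ`" and "such a vector killed by `P_λ` is entire off `[−λ,λ]`"
(`mem_sup_range_of_orthogonal`, `exists_entire_ae_eq_of_mem_sup_range`), the holomorphic extension
of `t ↦ ∂_w^k C_λ(t,w)` to `Re z > 0` (`exists_differentiableOn_iteratedDeriv_cosKernel`) and the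
identity theorem.  RH-FREE. bears_on: B-C/B-P (COLUMN 6 DBR) as corpus tooling.  WHAT THIS IS NOT:
not a criterion, not a route; nothing here bears on the truth of RH.

## References
* [Burnol2001CRAS] J.-F. Burnol, C. R. Acad. Sci. Paris 333 (2001) 201–206, §1, Théorème 1.5 and
  its proof (TeX l.393–412).
-/

noncomputable section

open _root_.MeasureTheory _root_.Complex _root_.Set _root_.Filter _root_.Metric
open scoped Real Topology FourierTransform ComplexConjugate

open Literature.NumberTheory.ConnesConsani2021 (soninSpace cutoffProj cutoffProjHat evenPart
  mem_evenPart_iff cutoffProj_coeFn)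
open Literature.Analysis.DeBrangesSpaces.SonineMellin (cosKernel cosKernel_neg)

namespace Literature.Analysis.DeBrangesSpaces

namespace Burnol2001

/-! ## A. Analytic continuation from a.e. equality on a half-line -/

/-- Two functions continuous on `(c, ∞)` that agree a.e. there agree everywhere there. [folklore] -/
private theorem eqOn_Ioi_of_ae_eq' {c : ℝ} {f g : ℝ → ℂ} (hf : ContinuousOn f (Ioi c))
    (hg : ContinuousOn g (Ioi c)) (h : ∀ᵐ t : ℝ, c < t → f t = g t) : EqOn f g (Ioi c) := by
  intro t₀ ht₀
  by_contra hne
  have hc : ContinuousWithinAt (fun t ↦ f t - g t) (Ioi c) t₀ := (hf t₀ ht₀).sub (hg t₀ ht₀)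
  have hne' : f t₀ - g t₀ ≠ 0 := sub_ne_zero.2 hne
  have hopen : IsOpen {z : ℂ | z ≠ 0} := isOpen_ne
  have hmem : {t | f t - g t ≠ 0} ∈ 𝓝[Ioi c] t₀ := hc (hopen.mem_nhds hne')
  obtain ⟨U, hU, hUo, ht₀U⟩ :
      ∃ U : Set ℝ, U ⊆ {t | t ∈ Ioi c → f t - g t ≠ 0} ∧ IsOpen U ∧ t₀ ∈ U := by
    rcases mem_nhdsWithin.1 hmem with ⟨U, hUo, hU0, hU⟩
    exact ⟨U, fun t ht htc ↦ hU ⟨ht, htc⟩, hUo, hU0⟩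
  have hpos : 0 < volume (U ∩ Ioi c) := by
    have ho : IsOpen (U ∩ Ioi c) := hUo.inter isOpen_Ioi
    exact ho.measure_pos volume ⟨t₀, ht₀U, ht₀⟩
  have hzero : volume (U ∩ Ioi c) = 0 := by
    have hsub : U ∩ Ioi c ⊆ {t | ¬(c < t → f t = g t)} := by
      rintro t ⟨htU, htc⟩ himp
      exact hU htU htc (sub_eq_zero.2 (himp htc))
    exact measure_mono_null hsub (ae_iff.1 h)
  exact hpos.ne' hzero

/-- **Identity theorem from a half-line**: a function holomorphic on `Re z > 0` and an entire function
that agree a.e. on `(λ, ∞)` (`λ > 0`) agree on `(0, ∞)` ("par analyticité", TeX l.410–412). [folklore] -/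
private theorem eq_of_differentiableOn_of_ae_eq {lam : ℝ} (hlam : 0 < lam) {V E : ℂ → ℂ}
    (hV : DifferentiableOn ℂ V {z : ℂ | 0 < z.re}) (hE : Differentiable ℂ E)
    (h : ∀ᵐ t : ℝ, lam < t → V t = E t) {t : ℝ} (ht : 0 < t) : V t = E t := by
  set U : Set ℂ := {z : ℂ | 0 < z.re} with hU
  have hUo : IsOpen U := isOpen_lt continuous_const Complex.continuous_re
  have hUc : IsPreconnected U := (convex_halfSpace_re_gt 0).isPreconnected
  have hreal : ∀ s : ℝ, 0 < s → ((s : ℂ) ∈ U) := fun s hs ↦ by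
    simp only [hU, mem_setOf_eq, Complex.ofReal_re]; exact hs
  -- (1) pointwise agreement on `(λ, ∞)`
  have hVc : ContinuousOn (fun s : ℝ ↦ V s) (Ioi lam) := fun s hs ↦
    ((hV _ (hreal s (hlam.trans hs))).continuousWithinAt.continuousAt (hUo.mem_nhds
      (hreal s (hlam.trans hs)))).comp_continuousWithinAt Complex.continuous_ofReal.continuousWithinAt
  have hEc : ContinuousOn (fun s : ℝ ↦ E s) (Ioi lam) :=
    (hE.continuous.comp Complex.continuous_ofReal).continuousOn
  have hEq : EqOn (fun s : ℝ ↦ V s) (fun s : ℝ ↦ E s) (Ioi lam) := eqOn_Ioi_of_ae_eq' hVc hEc h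
  -- (2) identity theorem on `U`
  have hVa : AnalyticOnNhd ℂ V U := hV.analyticOnNhd hUo
  have hEa : AnalyticOnNhd ℂ E U := hE.differentiableOn.analyticOnNhd hUo
  set z₀ : ℂ := ((lam + 1 : ℝ) : ℂ) with hz₀
  have hz₀U : z₀ ∈ U := hreal _ (by linarith)
  set u : ℕ → ℂ := fun n ↦ ((lam + 1 + 1 / ((n : ℝ) + 1) : ℝ) : ℂ) with hu
  have hu_lim : Tendsto u atTop (𝓝[≠] z₀) := by
    refine tendsto_nhdsWithin_iff.2 ⟨?_, Eventually.of_forall fun n ↦ ?_⟩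
    · have h1 : Tendsto (fun n : ℕ ↦ lam + 1 + 1 / ((n : ℝ) + 1)) atTop (𝓝 (lam + 1)) := by
        have := (tendsto_one_div_add_atTop_nhds_zero_nat).const_add (lam + 1)
        rwa [add_zero] at this
      have := (Complex.continuous_ofReal.tendsto (lam + 1)).comp h1
      rwa [hz₀]
    · rw [mem_compl_iff, mem_singleton_iff, hu, hz₀]
      intro h'
      have h'' := congrArg Complex.re h'
      simp only [Complex.ofReal_re] at h''
      have : (0 : ℝ) < 1 / ((n : ℝ) + 1) := by positivity
      linarith
  have hfreq : ∃ᶠ z in 𝓝[≠] z₀, V z = E z := by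
    refine hu_lim.frequently (Frequently.of_forall fun n ↦ ?_)
    have hn : lam < lam + 1 + 1 / ((n : ℝ) + 1) := by
      have : (0 : ℝ) < 1 / ((n : ℝ) + 1) := by positivity
      linarith
    exact hEq hn
  have hVE : EqOn V E U := hVa.eqOn_of_preconnected_of_frequently_eq hEa hUc hz₀U hfreq
  exact hVE (hreal t ht)

/-! ## B. The combination `Σ c_{w,k} D_{w,k}` is holomorphic on `Re z > 0` -/

/-- Each `D_{w,k}` — `(log 1/t)^k t^{−w}` for `Re w > 1/2`, `∂_w^k C_λ(t,w)` for `Re w ≤ 1/2` — and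
hence every finite combination, is the restriction to `(0,∞)` of a function holomorphic on
`Re z > 0` ("qui est analytique en `t` sur `]0,∞[`", TeX l.410–411; brick
`exists_differentiableOn_iteratedDeriv_cosKernel`). [cite: Burnol2001CRAS, proof of Théorème 1.5 (TeX l.409–412)] -/
theorem exists_differentiableOn_eq_sum {lam : ℝ} (hlam : 0 < lam) (s : Finset (ℂ × ℕ))
    (c : ℂ × ℕ → ℂ) :
    ∃ V : ℂ → ℂ, DifferentiableOn ℂ V {z : ℂ | 0 < z.re} ∧ ∀ t : ℝ, 0 < t →
      V t = ∑ p ∈ s, c p * (if 1 / 2 < p.1.re then (-(Real.log t : ℂ)) ^ p.2 * (t : ℂ) ^ (-p.1)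
        else iteratedDeriv p.2 (cosKernel lam t) p.1) := by
  set U : Set ℂ := {z : ℂ | 0 < z.re} with hU
  have hslit : ∀ z ∈ U, z ∈ slitPlane := fun z hz ↦ Or.inl hz
  have hp : ∀ p : ℂ × ℕ, ∃ Dc : ℂ → ℂ, DifferentiableOn ℂ Dc U ∧ ∀ t : ℝ, 0 < t →
      Dc t = (if 1 / 2 < p.1.re then (-(Real.log t : ℂ)) ^ p.2 * (t : ℂ) ^ (-p.1)
        else iteratedDeriv p.2 (cosKernel lam t) p.1) := by
    intro p
    by_cases h : 1 / 2 < p.1.re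
    · refine ⟨fun z ↦ (-Complex.log z) ^ p.2 * z ^ (-p.1), fun z hz ↦ ?_, fun t ht ↦ ?_⟩
      · exact ((((differentiableAt_id (𝕜 := ℂ) (x := z)).clog (hslit z hz)).neg.pow _).mul
          ((differentiableAt_id (𝕜 := ℂ) (x := z)).cpow_const (hslit z hz))).differentiableWithinAt
      · simp only [if_pos h]
        rw [← Complex.ofReal_log ht.le]
    · obtain ⟨Dc, hDc, hDc'⟩ := exists_differentiableOn_iteratedDeriv_cosKernel hlam p.2 p.1
      exact ⟨Dc, hDc, fun t ht ↦ by rw [hDc' t ht, if_neg h]⟩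
  choose Dc hDcd hDce using hp
  refine ⟨fun z ↦ ∑ p ∈ s, c p * Dc p z, ?_, fun t ht ↦ ?_⟩
  · exact DifferentiableOn.fun_sum fun p _ ↦ (differentiableOn_const _).fun_mul (hDcd p)
  · exact Finset.sum_congr rfl fun p _ ↦ by rw [hDce p t ht]

/-! ## C. The vectors and the orthogonality -/

/-- The even `L²(ℝ)` vector `𝟙_{|x|>λ} D_{w,k}(|x|)` (`BurnolXPairingRepresenters`).
[cite: Burnol2001CRAS, §1 (TeX l.393–396)] -/
private theorem memLp_indicator_D {lam : ℝ} (hlam : 0 < lam) (p : ℂ × ℕ) :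
    MemLp (Set.indicator {x : ℝ | lam < |x|} fun x : ℝ ↦
      (if 1 / 2 < p.1.re then (-(Real.log |x| : ℂ)) ^ p.2 * ((|x| : ℝ) : ℂ) ^ (-p.1)
        else iteratedDeriv p.2 (cosKernel lam |x|) p.1)) 2 (volume : Measure ℝ) := by
  by_cases h : 1 / 2 < p.1.re
  · have h1 := (memLp_indicator_log_pow_abs_cpow hlam p.2 h).const_mul ((-1 : ℂ) ^ p.2)
    refine MemLp.ae_eq (ae_of_all _ fun x ↦ ?_) h1
    simp only [if_pos h]
    by_cases hx : x ∈ {x : ℝ | lam < |x|}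
    · rw [indicator_of_mem hx, indicator_of_mem hx, neg_pow]; ring
    · rw [indicator_of_notMem hx, indicator_of_notMem hx, mul_zero]
  · have h1 := memLp_indicator_iteratedDeriv_cosKernel hlam hlam p.2 p.1
    refine MemLp.ae_eq (ae_of_all _ fun x ↦ ?_) h1
    simp only [if_neg h]
    have habs : cosKernel lam |x| = cosKernel lam x := by
      rcases le_or_gt 0 x with hx | hx
      · rw [abs_of_nonneg hx]
      · rw [abs_of_neg hx]; funext w'; exact cosKernel_neg lam x w'
    by_cases hx : x ∈ {x : ℝ | lam < |x|}
    · rw [indicator_of_mem hx, indicator_of_mem hx, habs]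
    · rw [indicator_of_notMem hx, indicator_of_notMem hx]

/-- **"La combinaison linéaire … doit être dans `𝓕₊(L²(]0,λ]))`" (TeX l.409–412)**: if
`Σ_{(w,k)∈s} c_{w,k} (f, X^λ_{w,k}] = 0` for every `f ∈ K_{λ,λ}` (all admissible Mellin data `(G,P)`),
then `t ↦ Σ c_{w,k} D_{w,k}(t)` — `D_{w,k}(t) = (log 1/t)^k t^{−w}` for `Re w > 1/2`, `∂_w^k C_λ(t,w)`
for `Re w ≤ 1/2` — coincides on ALL of `(0, ∞)` with an entire function: the even vector
`𝟙_{|t|>λ} conj(Σ c D(|t|))` is orthogonal to `K_{λ,λ}`, hence lies in `ran P_λ ⊔ ran P̂_λ`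
(`mem_sup_range_of_orthogonal`), hence is entire off `[−λ,λ]` (`exists_entire_ae_eq_of_mem_sup_range`),
and the identity propagates from `(λ,∞)` to `(0,∞)` by analyticity in `t`.
[cite: Burnol2001CRAS, Théorème 1.5, proof (TeX l.409–412)] -/
theorem exists_entire_eq_sum_of_pairings_eq_zero {lam : ℝ} (hlam : 0 < lam) (s : Finset (ℂ × ℕ))
    (c : ℂ × ℕ → ℂ)
    (hc : ∀ f : Lp ℂ 2 (volume : Measure ℝ), f ∈ soninSpace lam lam → ∀ G P : ℂ → ℂ,
      HasEntireMellin f G → IsXPairingFnC G P → ∑ p ∈ s, c p * xPairingR G P p.1 p.2 = 0) :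
    ∃ E : ℂ → ℂ, Differentiable ℂ E ∧ ∀ t : ℝ, 0 < t →
      ∑ p ∈ s, c p * (if 1 / 2 < p.1.re then (-(Real.log t : ℂ)) ^ p.2 * (t : ℂ) ^ (-p.1)
        else iteratedDeriv p.2 (cosKernel lam t) p.1) = E t := by
  -- the functions `D_p` and their combination `V`
  set D : ℂ × ℕ → ℝ → ℂ := fun p t ↦ if 1 / 2 < p.1.re then (-(Real.log t : ℂ)) ^ p.2 * (t : ℂ) ^ (-p.1)
    else iteratedDeriv p.2 (cosKernel lam t) p.1 with hD
  set V : ℝ → ℂ := fun t ↦ ∑ p ∈ s, c p * D p t with hV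
  have hSm : MeasurableSet {x : ℝ | lam < |x|} := measurableSet_lt measurable_const continuous_abs.measurable
  -- the `L²` vector `x ↦ 𝟙_{|x|>λ} V(|x|)` and its conjugate `q`
  set Vind : ℝ → ℂ := Set.indicator {x : ℝ | lam < |x|} (fun x ↦ V |x|) with hVind
  have hVind_eq : Vind = fun x ↦ ∑ p ∈ s, c p * Set.indicator {x : ℝ | lam < |x|} (fun x ↦ D p |x|) x := by
    funext x
    by_cases hx : x ∈ {x : ℝ | lam < |x|}
    · simp only [hVind, hV, indicator_of_mem hx]
    · simp only [hVind, indicator_of_notMem hx, mul_zero, Finset.sum_const_zero]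
  have hVind_mem : MemLp Vind 2 (volume : Measure ℝ) := by
    rw [hVind_eq]
    exact memLp_finsetSum s fun p _ ↦ (memLp_indicator_D hlam p).const_mul (c p)
  set qf : ℝ → ℂ := fun x ↦ conj (Vind x) with hqf
  have hqm : MemLp qf 2 (volume : Measure ℝ) :=
    MemLp.of_le hVind_mem (Complex.continuous_conj.comp_aestronglyMeasurable hVind_mem.1)
      (ae_of_all _ fun x ↦ by rw [hqf]; dsimp only; rw [Complex.norm_conj])
  set q : Lp ℂ 2 (volume : Measure ℝ) := hqm.toLp qf with hqdef
  have hq_coe : (q : ℝ → ℂ) =ᵐ[volume] qf := hqm.coeFn_toLp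
  have hVind_even : ∀ x : ℝ, Vind (-x) = Vind x := fun x ↦ by
    simp only [hVind, Set.indicator_apply, mem_setOf_eq, abs_neg]
  -- `q` is even
  have hq_even : q ∈ evenPart := by
    rw [mem_evenPart_iff]
    have h2 := (Measure.measurePreserving_neg (volume : Measure ℝ)).quasiMeasurePreserving.ae_eq_comp
      hq_coe
    filter_upwards [hq_coe, h2] with x hx hx'
    simp only [Function.comp_apply] at hx'
    rw [hx', hx, hqf]; dsimp only
    rw [hVind_even]
  -- `q ⊥ K_{λ,λ}`: `⟪q, f⟫ = ∫ 𝟙 V(|x|) f = 2∫_λ^∞ f V = 2 Σ c_p (f, X_p] = 0`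
  have horth : ∀ f ∈ soninSpace lam lam, inner ℂ f q = 0 := by
    intro f hf
    have hf' := hf
    obtain ⟨heven, hfa, -⟩ := hf'
    obtain ⟨G, hG⟩ := Burnol2001CRAS_thm1_1_holds lam lam hlam hlam f hf
    obtain ⟨P, hPd, hPeq⟩ := exists_compensated_pairing_fn hlam hf hG
    have hP : IsXPairingFnC G P := ⟨hPd, hPeq⟩
    have hsum0 := hc f hf G P hG hP
    -- the pairings as integrals
    have hpair : ∀ p ∈ s, xPairingR G P p.1 p.2 = ∫ t in Ioi lam, (f : ℝ → ℂ) t * D p t := by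
      intro p _
      by_cases h : 1 / 2 < p.1.re
      · rw [xPairingR_eq_setIntegral_of_re_gt hlam f hfa hG P p.2 h]
        refine setIntegral_congr_fun measurableSet_Ioi (fun t _ ↦ ?_)
        simp only [hD, if_pos h]
      · rw [xPairingR_eq_setIntegral_of_re_le hlam hf hG hP p.2 (not_lt.1 h)]
        refine setIntegral_congr_fun measurableSet_Ioi (fun t _ ↦ ?_)
        simp only [hD, if_neg h]
    have hint : ∀ p ∈ s, IntegrableOn (fun t : ℝ ↦ (f : ℝ → ℂ) t * D p t) (Ioi lam) := by
      intro p _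
      by_cases h : 1 / 2 < p.1.re
      · refine (integrableOn_mul_log_pow_cpow hlam f p.2 h).congr_fun (fun t _ ↦ ?_) measurableSet_Ioi
        simp only [hD, if_pos h]
      · refine (integrableOn_mul_iteratedDeriv_cosKernel hlam hlam f p.2 p.1).congr_fun (fun t _ ↦ ?_)
          measurableSet_Ioi
        simp only [hD, if_neg h]
    -- `∫_λ^∞ f V = Σ c_p ∫_λ^∞ f D_p = 0`
    have hIV : ∫ t in Ioi lam, (f : ℝ → ℂ) t * V t = 0 := by
      have h1 : (fun t : ℝ ↦ (f : ℝ → ℂ) t * V t) = fun t ↦ ∑ p ∈ s, c p * ((f : ℝ → ℂ) t * D p t) := by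
        funext t; simp only [hV, Finset.mul_sum]; refine Finset.sum_congr rfl fun p _ ↦ by ring
      rw [h1, integral_finsetSum s fun p hp ↦ (hint p hp).const_mul (c p)]
      simp_rw [integral_const_mul]
      rw [← hsum0]
      exact Finset.sum_congr rfl fun p hp ↦ by rw [hpair p hp]
    -- integrability of `conj q · f = Vind · f`
    have hint2 : Integrable (fun t : ℝ ↦ (f : ℝ → ℂ) t * Vind t) := by
      have h1 : Integrable (fun u : ℝ ↦ conj ((q : ℝ → ℂ) u) * (f : ℝ → ℂ) u) := by
        have := L2.integrable_inner (𝕜 := ℂ) q f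
        refine this.congr (ae_of_all _ fun u ↦ ?_)
        show inner ℂ _ _ = _
        rw [RCLike.inner_apply, mul_comm]
      refine h1.congr ?_
      filter_upwards [hq_coe] with u hu
      rw [hu, hqf]; dsimp only
      rw [Complex.conj_conj, mul_comm]
    have h1 : inner ℂ q f = 0 := by
      rw [MeasureTheory.L2.inner_def]
      have h2 : (fun x : ℝ ↦ inner ℂ ((q : ℝ → ℂ) x) ((f : ℝ → ℂ) x)) =ᵐ[volume]
          fun x ↦ (f : ℝ → ℂ) x * Vind x := by
        filter_upwards [hq_coe] with x hx
        rw [RCLike.inner_apply, hx, hqf]; dsimp only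
        rw [Complex.conj_conj]
      rw [integral_congr_ae h2, hVind,
        integral_mul_indicator_eq_two_mul_setIntegral hlam heven (fun x ↦ by rw [abs_neg]) ?_]
      · rw [show (fun t : ℝ ↦ (f : ℝ → ℂ) t * V |t|) = fun t : ℝ ↦ (f : ℝ → ℂ) t * V |t| from rfl]
        have h3 : ∫ t in Ioi lam, (f : ℝ → ℂ) t * V |t| = ∫ t in Ioi lam, (f : ℝ → ℂ) t * V t :=
          setIntegral_congr_fun measurableSet_Ioi (fun t ht ↦ by rw [abs_of_pos (hlam.trans ht)])
        rw [h3, hIV, mul_zero]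
      · rw [← hVind]; exact hint2
    rw [← inner_conj_symm, h1, map_zero]
  -- hence `q ∈ ran P_λ ⊔ ran P̂_λ`, `P_λ q = 0`, and `q` is entire off `[−λ, λ]`
  have hqW := mem_sup_range_of_orthogonal hq_even horth
  have hPq : cutoffProj lam q = 0 := by
    refine Lp.ext ?_
    filter_upwards [cutoffProj_coeFn lam q, hq_coe, Lp.coeFn_zero ℂ 2 (volume : Measure ℝ)]
      with t h1 h2 h3
    rw [h1, h3, Pi.zero_apply]
    by_cases ht : t ∈ Icc (-lam) lam
    · rw [indicator_of_mem ht, h2, hqf]; dsimp only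
      rw [hVind, indicator_of_notMem, map_zero]
      simp only [mem_setOf_eq, not_lt]
      exact abs_le.2 ⟨ht.1, ht.2⟩
    · rw [indicator_of_notMem ht]
  obtain ⟨E, hE, hqE⟩ := exists_entire_ae_eq_of_mem_sup_range hqW hPq
  -- the conjugate entire function `Ē` agrees with `V` a.e. on `(λ,∞)`
  set Ebar : ℂ → ℂ := fun z ↦ conj (E (conj z)) with hEbar
  have hEbar_d : Differentiable ℂ Ebar := by
    intro z
    have h := (hE (conj z)).conj_conj
    rw [Complex.conj_conj] at h
    exact h
  have hae : ∀ᵐ t : ℝ, lam < t → V t = Ebar t := by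
    filter_upwards [hqE, hq_coe] with t h1 h2 ht
    have ht0 : 0 < t := hlam.trans ht
    have hnot : t ∉ Icc (-lam) lam := fun h ↦ (not_le.2 ht) h.2
    have h3 : qf t = E t := by rw [← h2]; exact h1 hnot
    rw [hqf] at h3; dsimp only at h3
    rw [hVind, indicator_of_mem (by simpa [abs_of_pos ht0] using ht), abs_of_pos ht0] at h3
    rw [hEbar]; dsimp only
    rw [Complex.conj_ofReal, ← h3, Complex.conj_conj]
  -- holomorphic extension of `V` and the identity theorem
  obtain ⟨Vc, hVcd, hVce⟩ := exists_differentiableOn_eq_sum hlam s c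
  have hae' : ∀ᵐ t : ℝ, lam < t → Vc t = Ebar t := by
    filter_upwards [hae] with t h ht
    rw [hVce t (hlam.trans ht)]
    exact h ht
  refine ⟨Ebar, hEbar_d, fun t ht ↦ ?_⟩
  rw [← hVce t ht]
  exact eq_of_differentiableOn_of_ae_eq hlam hVcd hEbar_d hae' ht

end Burnol2001

end Literature.Analysis.DeBrangesSpaces
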